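import Summits.QuantumAdvantage.QuantumAdvantage.Theorems.CubicForrelationNearExactIsExactWalshTower
import Summits.QuantumAdvantage.QuantumAdvantage.Theorems.CubicForrelationNearExactIsExactAxParity
import Summits.QuantumAdvantage.QuantumAdvantage.Theorems.CubicForrelationNearExactIsExactMmNormalForm

/-!
# Crux `CubicForrelation.NearExactIsExact` (stmt-QuantumAdvantage-14043), line `direct-sum-amplification`, lead c6 cycle 2:
  stub `stub_linearTransport` — linear change of coordinates: forrelation invariance and Walsh transport

For matrices `M, M'` over `𝔽₂` with `M'M = 1`, the pair `f₁ = f ∘ M`, `g₁ = g ∘ M'ᵀ` (bit-vectors read in `𝔽₂` via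
`ind`, back via `decide (· = 1)`) has the same forrelation, and `W_{g₁}(x) = W_g(Mx)`.  This packages the final `calc` block of
the landed `stub_mmNormalForm` (`…MmNormalForm.lean`, lines 200–245: `⟨x, M y⟩ = ⟨Mᵀ x, y⟩` via `Matrix.dotProduct_mulVec`,
`dnf_twist_eq_chi`, and two `Equiv.sum_comp` reindexings; `M'M = 1 ⇒ MM' = 1` for square matrices via
`Matrix.mul_eq_one_comm`).  Degrees are transported separately by the landed `nf_isDegLeFun_mulVec`.  Used by the lead to put
the split covector of the `n = 10` analysis on the last coordinate and the linear structure of `δ` on `e₉`.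
-/

set_option linter.dupNamespace false -- D-0017: single-problem summit ⇒ `QuantumAdvantage.QuantumAdvantage` by design

noncomputable section

namespace Summit.QuantumAdvantage.QuantumAdvantage.Theorems.CubicForrelation.NearExactIsExact

open Finset
open Literature.Computability.QuantumComplexity
open Literature.Computability.QuantumComplexity.BuzetChailloux (bxor zeroVec signOf_sq)
open Literature.Computability.QuantumComplexity.DerivativeWalsh (W)
open Summit.QuantumAdvantage.QuantumAdvantage.Theorems.ExactPairsMaioranaMcFarland.Negative (ind ind_apply ind_injective)
open Summit.QuantumAdvantage.QuantumAdvantage.Theorems.CubicForrelation.ExactPairsMaioranaMcFarland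
  (dnf_twist_eq_chi)
open scoped Matrix

/-! ### The Bool / `ZMod 2` dictionary: `x ↦ ind x` and back `v ↦ (decide (v i = 1))_i` -/

/-- Reading a `ZMod 2`-vector as a bit-vector (`v ↦ (decide (v i = 1))_i`) and then taking indicators is the
identity. -/
theorem lt_ind_decide {n : ℕ} (v : Fin n → ZMod 2) : ind (fun i => decide (v i = 1)) = v := by
  funext i
  exact (by decide : ∀ a : ZMod 2, (if decide (a = 1) = true then (1 : ZMod 2) else 0) = a) (v i)

/-- Taking indicators and reading back as a bit-vector is the identity. -/
theorem lt_decide_ind {n : ℕ} (x : Fin n → Bool) : (fun i => decide (ind x i = 1)) = x := by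
  funext i
  rw [ind_apply]
  cases x i <;> decide

/-- Adjunction for the twist: `⟨x, N y⟩ = ⟨Nᵀ x, y⟩`, i.e.
`twist x (N y) = twist (Nᵀ x) y` (bit-vectors read in `ZMod 2` along `ind`). -/
theorem lt_twist_mulVec {n : ℕ} (N : Matrix (Fin n) (Fin n) (ZMod 2)) (x y : Fin n → Bool) :
    twist x (fun i => decide ((N *ᵥ ind y) i = 1)) =
      twist (fun i => decide ((Nᵀ *ᵥ ind x) i = 1)) y := by
  rw [dnf_twist_eq_chi, dnf_twist_eq_chi, lt_ind_decide, lt_ind_decide, Matrix.dotProduct_mulVec,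
    ← Matrix.mulVec_transpose]

/-- If `A B = 1` then `x ↦ A x` is a left inverse of `x ↦ B x` on bit-vectors. -/
theorem lt_leftInverse {n : ℕ} (A B : Matrix (Fin n) (Fin n) (ZMod 2)) (h : A * B = 1)
    (x : Fin n → Bool) :
    (fun i => decide ((A *ᵥ ind fun j => decide ((B *ᵥ ind x) j = 1)) i = 1)) = x := by
  rw [lt_ind_decide, Matrix.mulVec_mulVec, h, Matrix.one_mulVec, lt_decide_ind]

/-- If `A B = 1` then `x ↦ B x` is a bijection of the bit-vectors. -/
theorem lt_bijective {n : ℕ} (A B : Matrix (Fin n) (Fin n) (ZMod 2)) (h : A * B = 1) :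
    Function.Bijective (fun x : Fin n → Bool => fun i => decide ((B *ᵥ ind x) i = 1)) :=
  Finite.injective_iff_bijective.1
    (Function.LeftInverse.injective
      (g := fun x : Fin n → Bool => fun i => decide ((A *ᵥ ind x) i = 1)) (lt_leftInverse A B h))

/-! ### Walsh transport and forrelation invariance -/

/-- **Walsh transport under the contragredient change of coordinates.**  For `M' M = 1` over `𝔽₂`:
`W_{g ∘ M'ᵀ}(x) = W_g(M x)` (reindex `y ↦ Mᵀ y`, whose inverse is `M'ᵀ` since `M M' = 1` for square matrices,
and use `⟨Mᵀ y, x⟩ = ⟨y, M x⟩`). -/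
theorem lt_W_transport {n : ℕ} (M M' : Matrix (Fin n) (Fin n) (ZMod 2)) (hM'M : M' * M = 1)
    (g : (Fin n → Bool) → Bool) (x : Fin n → Bool) :
    W (fun y => signOf (g (fun i => decide ((M'ᵀ *ᵥ ind y) i = 1)))) x =
      W (fun y => signOf (g y)) (fun i => decide ((M *ᵥ ind x) i = 1)) := by
  have hT : M'ᵀ * Mᵀ = 1 := by
    rw [← Matrix.transpose_mul, mul_eq_one_comm.1 hM'M, Matrix.transpose_one]
  simp only [W]
  symm
  refine Fintype.sum_bijective _ (lt_bijective M'ᵀ Mᵀ hT) _ _ fun y => ?_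
  rw [lt_leftInverse M'ᵀ Mᵀ hT y, lt_twist_mulVec M y x]

/-- **Linear change of coordinates and its contragredient preserve the forrelation and transport the Walsh
transform.**  For `M'M = 1` over `𝔽₂`, with `f₁ = f ∘ M` and `g₁ = g ∘ M'ᵀ`: `Φ(f₁,g₁) = Φ(f,g)` and `W_{g₁}(x) = W_g(Mx)`.
[linear algebra; the calc block of the landed `stub_mmNormalForm`] -/
theorem stub_linearTransport :
    ∀ (n : ℕ) (M M' : Matrix (Fin n) (Fin n) (ZMod 2)), M' * M = 1 →
      ∀ (f g : (Fin n → Bool) → Bool),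
        forrelation (fun x => f (fun i => decide ((M *ᵥ ind x) i = 1)))
            (fun y => g (fun i => decide ((M'ᵀ *ᵥ ind y) i = 1))) = forrelation f g ∧
        ∀ x, W (fun y => signOf (g (fun i => decide ((M'ᵀ *ᵥ ind y) i = 1)))) x =
          W (fun y => signOf (g y)) (fun i => decide ((M *ᵥ ind x) i = 1)) := by
  intro n M M' hM'M f g
  refine ⟨?_, fun x => lt_W_transport M M' hM'M g x⟩
  have hT' : Mᵀ * M'ᵀ = 1 := by rw [← Matrix.transpose_mul, hM'M, Matrix.transpose_one]
  unfold forrelation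
  congr 1
  -- reindex `x ↦ M x` (inverse `M'`), swap, then reindex `y ↦ M'ᵀ y` (inverse `Mᵀ`) using `⟨x, M'ᵀ y⟩ = ⟨M' x, y⟩`
  calc ∑ x, ∑ y, signOf (f (fun i => decide ((M *ᵥ ind x) i = 1))) * twist x y *
          signOf (g (fun i => decide ((M'ᵀ *ᵥ ind y) i = 1)))
      = ∑ y, ∑ x, signOf (f (fun i => decide ((M *ᵥ ind x) i = 1))) * twist x y *
          signOf (g (fun i => decide ((M'ᵀ *ᵥ ind y) i = 1))) := Finset.sum_comm
    _ = ∑ y, ∑ x, signOf (f x) * twist (fun i => decide ((M' *ᵥ ind x) i = 1)) y *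
          signOf (g (fun i => decide ((M'ᵀ *ᵥ ind y) i = 1))) :=
        Finset.sum_congr rfl fun y _ =>
          Fintype.sum_bijective _ (lt_bijective M' M hM'M) _ _ fun x => by
            rw [lt_leftInverse M' M hM'M x]
    _ = ∑ x, ∑ y, signOf (f x) * twist (fun i => decide ((M' *ᵥ ind x) i = 1)) y *
          signOf (g (fun i => decide ((M'ᵀ *ᵥ ind y) i = 1))) := Finset.sum_comm
    _ = ∑ x, ∑ y, signOf (f x) * twist x y * signOf (g y) :=
        Finset.sum_congr rfl fun x _ =>
          Fintype.sum_bijective _ (lt_bijective Mᵀ M'ᵀ hT') _ _ fun y => by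
            rw [lt_twist_mulVec M'ᵀ x y, Matrix.transpose_transpose]

end Summit.QuantumAdvantage.QuantumAdvantage.Theorems.CubicForrelation.NearExactIsExact
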